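import Summits.CriticalPhenomena.SAWScalingLimit.Theorems.SAWDevelopingMapObservableToSLECanonicalTransferLatticeChains
import Literature.Probability.Percolation.SitePaths
import HarnessLib

/-!
# Crux `SAWDevelopingMap.ObservableToSLE` (stmt-CriticalPhenomena-10472), line
`floor-ratio-restriction-bootstrap`, stub `stub_canonicalTransfer`: the escape lemma (T2) of the
inner admissible discretisation (M1)

Landing target:
`Summits/CriticalPhenomena/SAWScalingLimit/Theorems/SAWDevelopingMapObservableToSLECanonicalTransferEscape.lean`
(`--supports stmt-CriticalPhenomena-10472`).  Sequel of `…CanonicalTransferLatticeChains.lean`.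

The inner admissible family of a floor Jordan domain `Ω` (above the line `Im = h`, flat near the
floor points `p₀`, `p₁`) is the main component of the set `S` of DEEP vertices: `δ c_u ∈ Ω`, row
above the floor row (height `≥ η`), closed `r`-disc about `δ c_u` inside
`Ω ∪ B(p₀, ϱ) ∪ B(p₁, ϱ)`.  Its simple connectivity rests on the ESCAPE LEMMA proved here: every
non-deep vertex is joined, avoiding `S`, to a vertex below the floor (`Im ≤ h - 5δ`).  No
Janiszewski-type separation is needed: the whole open lower half-plane lies in the connected
exterior `(cl Ω)ᶜ` of the Jordan domain.

* `exists_walk_down`, `exists_walk_up` — greedy vertical walks (height monotone at the ends,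
  lateral spread `≤ 2L`);
* `exists_pathIn_towards`, `exists_pathIn_down_of_witness`, `exists_pathIn_down_of_height` — the
  three elementary escape routes (towards a witness point outside `U`, `10δ` down next to a
  witness, down below strictly higher deep vertices);
* `exists_mem_compl_closure_near`, `exists_first_entry` — continuum inputs (exterior points next
  to non-domain points; first entry of a path into a closed set);
* `exists_pathIn_escape` = registered sub-goal `stub_canonicalTransfer_escape` — **the escape
  lemma**.
-/

noncomputable section

open scoped Topology
open Filter Set Metric
open Literature.Probability.LatticeModels (HexVertex hexGraph hexCenter Site)
open Literature.Probability.RandomPlanarGeometry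
open Literature.Probability.RandomPlanarGeometry.SAW
open Literature.Probability.Percolation (PathIn)

namespace Summit.CriticalPhenomena.SAWScalingLimit.Theorems.ObservableToSLE.FloorRatio

/-! ### Vertical greedy walks -/

/-- **Greedy descent by `L`.**  From any vertex `v` there is a honeycomb walk ending at height
`≤ Im(δ c_v) - L + δ` all of whose vertices are no higher than `δ c_v` and within `2L` of it
(greedy descent towards the point `L` below `δ c_v`: the walk stays in the closed disc of radius
`L` about that point, whose top is `δ c_v`). [folklore] -/
theorem exists_walk_down {δ : ℝ} (hδ : 0 < δ) (v : HexVertex) {L : ℝ} (hL : 0 ≤ L) :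
    ∃ (z : HexVertex) (p : hexGraph.Walk v z),
      ((δ : ℂ) * hexCenter z).im ≤ ((δ : ℂ) * hexCenter v).im - L + δ ∧
      ∀ u ∈ p.support, ((δ : ℂ) * hexCenter u).im ≤ ((δ : ℂ) * hexCenter v).im ∧
        dist ((δ : ℂ) * hexCenter u) ((δ : ℂ) * hexCenter v) ≤ 2 * L := by
  set y : ℂ := (δ : ℂ) * hexCenter v - (L : ℂ) * Complex.I with hy
  have hvy : dist ((δ : ℂ) * hexCenter v) y = L := by
    rw [dist_eq_norm, hy, sub_sub_cancel, norm_mul, Complex.norm_real, Complex.norm_I, mul_one,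
      Real.norm_of_nonneg hL]
  have hyim : y.im = ((δ : ℂ) * hexCenter v).im - L := by simp [hy]
  obtain ⟨z, p, hz, hp⟩ := exists_walk_dist_smul_le hδ v y
  have h3 : δ / Real.sqrt 3 ≤ δ := by
    refine div_le_self hδ.le ?_
    rw [show (1 : ℝ) = Real.sqrt 1 by simp]
    exact Real.sqrt_le_sqrt (by norm_num)
  refine ⟨z, p, ?_, fun u hu => ⟨?_, ?_⟩⟩
  · have h1 : ((δ : ℂ) * hexCenter z).im - y.im ≤ dist ((δ : ℂ) * hexCenter z) y := by
      rw [dist_eq_norm, ← Complex.sub_im]; exact Complex.im_le_norm _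
    linarith
  · have h1 : ((δ : ℂ) * hexCenter u).im - y.im ≤ dist ((δ : ℂ) * hexCenter u) y := by
      rw [dist_eq_norm, ← Complex.sub_im]; exact Complex.im_le_norm _
    have h2 := hp u hu
    linarith
  · calc dist ((δ : ℂ) * hexCenter u) ((δ : ℂ) * hexCenter v)
        ≤ dist ((δ : ℂ) * hexCenter u) y + dist ((δ : ℂ) * hexCenter v) y :=
          dist_triangle_right _ _ _
      _ ≤ L + L := add_le_add ((hp u hu).trans_eq hvy) hvy.le
      _ = 2 * L := by ring

/-- **Greedy ascent by `L`.**  From any vertex `v` there is a honeycomb walk ending within `δ` of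
the point `δ c_v + iL` all of whose vertices are no lower than `δ c_v` and within `2L` of it.
[folklore] -/
theorem exists_walk_up {δ : ℝ} (hδ : 0 < δ) (v : HexVertex) {L : ℝ} (hL : 0 ≤ L) :
    ∃ (z : HexVertex) (p : hexGraph.Walk v z),
      dist ((δ : ℂ) * hexCenter z) ((δ : ℂ) * hexCenter v + (L : ℂ) * Complex.I) ≤ δ ∧
      ∀ u ∈ p.support, ((δ : ℂ) * hexCenter v).im ≤ ((δ : ℂ) * hexCenter u).im ∧
        dist ((δ : ℂ) * hexCenter u) ((δ : ℂ) * hexCenter v) ≤ 2 * L := by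
  set y : ℂ := (δ : ℂ) * hexCenter v + (L : ℂ) * Complex.I with hy
  have hvy : dist ((δ : ℂ) * hexCenter v) y = L := by
    rw [dist_comm, dist_eq_norm, hy, add_sub_cancel_left, norm_mul, Complex.norm_real,
      Complex.norm_I, mul_one, Real.norm_of_nonneg hL]
  have hyim : y.im = ((δ : ℂ) * hexCenter v).im + L := by simp [hy]
  obtain ⟨z, p, hz, hp⟩ := exists_walk_dist_smul_le hδ v y
  have h3 : δ / Real.sqrt 3 ≤ δ := by
    refine div_le_self hδ.le ?_
    rw [show (1 : ℝ) = Real.sqrt 1 by simp]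
    exact Real.sqrt_le_sqrt (by norm_num)
  refine ⟨z, p, hz.trans h3, fun u hu => ⟨?_, ?_⟩⟩
  · have h1 : y.im - ((δ : ℂ) * hexCenter u).im ≤ dist ((δ : ℂ) * hexCenter u) y := by
      rw [dist_comm, dist_eq_norm, ← Complex.sub_im]; exact Complex.im_le_norm _
    have h2 := hp u hu
    linarith
  · calc dist ((δ : ℂ) * hexCenter u) ((δ : ℂ) * hexCenter v)
        ≤ dist ((δ : ℂ) * hexCenter u) y + dist ((δ : ℂ) * hexCenter v) y :=
          dist_triangle_right _ _ _
      _ ≤ L + L := add_le_add ((hp u hu).trans_eq hvy) hvy.le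
      _ = 2 * L := by ring

/-! ### Three elementary escape routes -/

/-- **Towards a witness.**  If the `r`-discs about the vertices of `S` lie in `U` and `y ∉ U` is
within `r` of `δ c_v`, greedy descent towards `y` runs outside `S` and ends within `δ` of `y`.
[folklore] -/
theorem exists_pathIn_towards {S : Set HexVertex} {U : Set ℂ} {δ r : ℝ} (hδ : 0 < δ)
    (hS : ∀ u ∈ S, closedBall ((δ : ℂ) * hexCenter u) r ⊆ U) {v : HexVertex} {y : ℂ}
    (hy : y ∉ U) (hvy : dist ((δ : ℂ) * hexCenter v) y ≤ r) :
    ∃ z : HexVertex, dist ((δ : ℂ) * hexCenter z) y ≤ δ ∧ PathIn hexGraph Sᶜ v z := by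
  obtain ⟨z, p, hz, hp⟩ := exists_walk_dist_smul_le hδ v y
  have h3 : δ / Real.sqrt 3 ≤ δ := by
    refine div_le_self hδ.le ?_
    rw [show (1 : ℝ) = Real.sqrt 1 by simp]
    exact Real.sqrt_le_sqrt (by norm_num)
  refine ⟨z, hz.trans h3, pathIn_of_walk p fun u hu huS => hy (hS u huS ?_)⟩
  rw [mem_closedBall, dist_comm]
  exact (hp u hu).trans hvy

/-- **Final descent next to a witness.**  If `p ∉ U` is within `2δ` of `δ c_z`, `δ c_z` is at
height `≤ h + 3δ` and `25δ ≤ r`, greedy descent by `10δ` from `z` runs outside `S` (all its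
vertices are within `22δ ≤ r` of the witness `p`) and ends at height `≤ h - 5δ`. [folklore] -/
theorem exists_pathIn_down_of_witness {S : Set HexVertex} {U : Set ℂ} {δ r h : ℝ} (hδ : 0 < δ)
    (hr : 25 * δ ≤ r) (hS : ∀ u ∈ S, closedBall ((δ : ℂ) * hexCenter u) r ⊆ U) {z : HexVertex}
    {p : ℂ} (hp : p ∉ U) (hzp : dist ((δ : ℂ) * hexCenter z) p ≤ 2 * δ)
    (hz : ((δ : ℂ) * hexCenter z).im ≤ h + 3 * δ) :
    ∃ w : HexVertex, ((δ : ℂ) * hexCenter w).im ≤ h - 5 * δ ∧ PathIn hexGraph Sᶜ z w := by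
  obtain ⟨w, q, hw, hq⟩ := exists_walk_down hδ z (L := 10 * δ) (by positivity)
  refine ⟨w, by linarith, pathIn_of_walk q fun u hu huS => hp (hS u huS ?_)⟩
  rw [mem_closedBall]
  calc dist p ((δ : ℂ) * hexCenter u) = dist ((δ : ℂ) * hexCenter u) p := dist_comm _ _
    _ ≤ dist ((δ : ℂ) * hexCenter u) ((δ : ℂ) * hexCenter z) + dist ((δ : ℂ) * hexCenter z) p :=
        dist_triangle _ _ _
    _ ≤ 2 * (10 * δ) + 2 * δ := add_le_add (hq u hu).2 hzp
    _ ≤ r := by linarith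

/-- **Descent below higher vertices.**  If every vertex of `S` is strictly higher than `δ c_v`,
greedy descent from `v` runs outside `S` down to height `≤ h - 5δ`. [folklore] -/
theorem exists_pathIn_down_of_height {S : Set HexVertex} {δ h : ℝ} (hδ : 0 < δ) {v : HexVertex}
    (hS : ∀ u ∈ S, ((δ : ℂ) * hexCenter v).im < ((δ : ℂ) * hexCenter u).im) :
    ∃ w : HexVertex, ((δ : ℂ) * hexCenter w).im ≤ h - 5 * δ ∧ PathIn hexGraph Sᶜ v w := by
  rcases le_or_gt (((δ : ℂ) * hexCenter v).im) (h - 5 * δ) with hle | hlt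
  · exact ⟨v, hle, PathIn.refl fun hvS => lt_irrefl _ (hS v hvS)⟩
  · obtain ⟨w, q, hw, hq⟩ :=
      exists_walk_down hδ v (L := ((δ : ℂ) * hexCenter v).im - (h - 6 * δ)) (by linarith)
    refine ⟨w, by linarith, pathIn_of_walk q fun u hu huS => ?_⟩
    have := hS u huS
    have := (hq u hu).1
    linarith

/-! ### Continuum inputs: exterior points and first entries -/

/-- Points outside `Ω` are limits of exterior points, when the exterior `(cl Ω)ᶜ` has frontier
`∂Ω` (Jordan domains). [folklore] -/
theorem exists_mem_compl_closure_near {Ω : Set ℂ} (hfr : frontier (closure Ω)ᶜ = frontier Ω)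
    {y : ℂ} (hy : y ∉ Ω) {ε : ℝ} (hε : 0 < ε) : ∃ e ∈ (closure Ω)ᶜ, dist e y < ε := by
  by_cases hyc : y ∈ closure Ω
  · have hyf : y ∈ frontier Ω := ⟨hyc, fun h => hy (interior_subset h)⟩
    rw [← hfr] at hyf
    obtain ⟨e, he, hed⟩ := Metric.mem_closure_iff.1 (frontier_subset_closure hyf) ε hε
    exact ⟨e, he, by rwa [dist_comm]⟩
  · exact ⟨y, hyc, by rwa [dist_self]⟩

/-- **First entry of a path into a closed set.**  A path from outside the closed set `S` to a
point of `S` has a first parameter `t` in `S`; there the path is not interior to `S`, and before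
`t` it is outside `S`. [folklore] -/
theorem exists_first_entry {S : Set ℂ} (hS : IsClosed S) {x y : ℂ} (γ : Path x y) (hx : x ∉ S)
    (hy : y ∈ S) :
    ∃ t ∈ Icc (0 : ℝ) 1, γ.extend t ∈ S ∧ γ.extend t ∉ interior S ∧
      ∀ s ∈ Ico (0 : ℝ) t, γ.extend s ∉ S := by
  set T : Set ℝ := Icc 0 1 ∩ γ.extend ⁻¹' S with hT
  have hTc : IsCompact T := isCompact_Icc.inter_right (hS.preimage γ.continuous_extend)
  have h1T : (1 : ℝ) ∈ T := ⟨⟨zero_le_one, le_rfl⟩, by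
    show γ.extend 1 ∈ S
    rw [γ.extend_one]; exact hy⟩
  have htT : sInf T ∈ T := hTc.sInf_mem ⟨1, h1T⟩
  set t := sInf T with ht
  have hbefore : ∀ s ∈ Ico (0 : ℝ) t, γ.extend s ∉ S := by
    intro s hs hsS
    have hsT : s ∈ T := ⟨⟨hs.1, hs.2.le.trans htT.1.2⟩, hsS⟩
    exact hs.2.not_ge (csInf_le hTc.bddBelow hsT)
  have ht0 : 0 < t := by
    rcases eq_or_lt_of_le htT.1.1 with h0 | h0
    · exfalso
      have : γ.extend t ∈ S := htT.2
      rw [← h0, γ.extend_zero] at this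
      exact hx this
    · exact h0
  refine ⟨t, htT.1, htT.2, fun hint => ?_, hbefore⟩
  obtain ⟨ε, hε, hball⟩ := Metric.isOpen_iff.1 (isOpen_interior.preimage γ.continuous_extend) t hint
  set s : ℝ := max 0 (t - ε / 2) with hs
  have hst : s < t := max_lt ht0 (by linarith)
  have hsball : s ∈ ball t ε := by
    rw [mem_ball, Real.dist_eq, abs_sub_lt_iff]
    constructor <;> [linarith; (have := le_max_right 0 (t - ε / 2); linarith)]
  exact hbefore s ⟨le_max_left _ _, hst⟩ (interior_subset (hball hsball))


/-! ### The escape lemma -/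

/-- **Escape of non-deep vertices (T2).**  Setting: `Ω` open, lying above the line `Im = h`,
with connected exterior `(cl Ω)ᶜ` whose frontier is `∂Ω` (any Jordan domain), and flat near two
floor points `p₀`, `p₁` (`{Im > h} ∩ B(pᵢ, ρ) ⊆ Ω`).  Let `S` be any set of "deep" vertices:
`δ c_u ∈ Ω`, height `≥ η`, and the closed `r`-disc about `δ c_u` inside
`U = Ω ∪ B(p₀, ϱ) ∪ B(p₁, ϱ)` (`ϱ + δ ≤ ρ`, `25δ ≤ r`).  Then every vertex `v` violating one of
these three conditions is joined OUTSIDE `S` to a vertex at height `≤ h - 5δ` (below the floor):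
by greedy descent if `δ c_v` is low, and otherwise by descending to a witness `y ∉ U`, following an
exterior path from a nearby exterior point until it first gets below height `h - 6δ` or into one
of the closed discs `B̄(pᵢ, ϱ)` (all lattice vertices within `8δ` of it see an exterior witness
outside the open discs), and descending `10δ` from there. [folklore] -/
theorem exists_pathIn_escape {Ω : Set ℂ} {h ρ ϱ δ r η : ℝ} {p₀ p₁ : ℂ} {S : Set HexVertex}
    (hΩh : Ω ⊆ {z : ℂ | h < z.im}) (hE : IsConnected (closure Ω)ᶜ)
    (hEfr : frontier (closure Ω)ᶜ = frontier Ω)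
    (hfl₀ : {z : ℂ | h < z.im} ∩ ball p₀ ρ ⊆ Ω) (hfl₁ : {z : ℂ | h < z.im} ∩ ball p₁ ρ ⊆ Ω)
    (hϱρ : ϱ + δ ≤ ρ) (hδ : 0 < δ) (hr : 25 * δ ≤ r)
    (hS : ∀ u ∈ S, (δ : ℂ) * hexCenter u ∈ Ω ∧ η ≤ ((δ : ℂ) * hexCenter u).im ∧
      closedBall ((δ : ℂ) * hexCenter u) r ⊆ Ω ∪ ball p₀ ϱ ∪ ball p₁ ϱ)
    {v : HexVertex}
    (hv : ¬ ((δ : ℂ) * hexCenter v ∈ Ω ∧ η ≤ ((δ : ℂ) * hexCenter v).im ∧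
      closedBall ((δ : ℂ) * hexCenter v) r ⊆ Ω ∪ ball p₀ ϱ ∪ ball p₁ ϱ)) :
    ∃ w : HexVertex, ((δ : ℂ) * hexCenter w).im ≤ h - 5 * δ ∧ PathIn hexGraph Sᶜ v w := by
  set U : Set ℂ := Ω ∪ ball p₀ ϱ ∪ ball p₁ ϱ with hU
  have hSU : ∀ u ∈ S, closedBall ((δ : ℂ) * hexCenter u) r ⊆ U := fun u hu => (hS u hu).2.2
  have h8r : 8 * δ ≤ r := by linarith
  -- points of `U ∖ Ω` near the floor points are on or below the floor
  have hflat : ∀ z : ℂ, z ∉ Ω → (dist z p₀ < ρ ∨ dist z p₁ < ρ) → z.im ≤ h := by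
    intro z hzΩ hz
    by_contra hzh
    push Not at hzh
    rcases hz with hz | hz
    · exact hzΩ (hfl₀ ⟨hzh, hz⟩)
    · exact hzΩ (hfl₁ ⟨hzh, hz⟩)
  -- THE WITNESS ROUTE: from a vertex within `r` of a point `y ∉ U`
  have key : ∀ (v : HexVertex) (y : ℂ), y ∉ U → dist ((δ : ℂ) * hexCenter v) y ≤ r →
      ∃ w : HexVertex, ((δ : ℂ) * hexCenter w).im ≤ h - 5 * δ ∧ PathIn hexGraph Sᶜ v w := by
    intro v y hyU hvy
    have hyΩ : y ∉ Ω := fun h' => hyU (Or.inl (Or.inl h'))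
    have hy₀ : y ∉ ball p₀ ϱ := fun h' => hyU (Or.inl (Or.inr h'))
    have hy₁ : y ∉ ball p₁ ϱ := fun h' => hyU (Or.inr h')
    -- (b) descend towards the witness
    obtain ⟨z₁, hz₁y, hvz₁⟩ := exists_pathIn_towards hδ hSU hyU hvy
    -- (c) an exterior point next to the witness
    obtain ⟨e, heE, hey⟩ := exists_mem_compl_closure_near hEfr hyΩ hδ
    -- the stopping set
    set Sx : Set ℂ := {z : ℂ | z.im ≤ h - 6 * δ} ∪ closedBall p₀ ϱ ∪ closedBall p₁ ϱ with hSx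
    have hSxc : IsClosed Sx :=
      ((isClosed_le Complex.continuous_im continuous_const).union isClosed_closedBall).union
        isClosed_closedBall
    have hintSx : ball p₀ ϱ ∪ ball p₁ ϱ ⊆ interior Sx :=
      interior_maximal (union_subset (fun z hz => Or.inl (Or.inr (ball_subset_closedBall hz)))
        fun z hz => Or.inr (ball_subset_closedBall hz)) (isOpen_ball.union isOpen_ball)
    by_cases heS : e ∈ Sx
    · -- the witness is already low: descend from `z₁`
      have hyim : y.im ≤ h := by
        rcases heS with (he | he) | he
        · have h1 : y.im - e.im ≤ dist e y := by
            rw [dist_comm, dist_eq_norm, ← Complex.sub_im]; exact Complex.im_le_norm _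
          have h2 : e.im ≤ h - 6 * δ := he
          linarith
        · refine hflat y hyΩ (Or.inl ?_)
          calc dist y p₀ ≤ dist e y + dist e p₀ := dist_triangle_left _ _ _
            _ < δ + ϱ := add_lt_add_of_lt_of_le hey (mem_closedBall.1 he)
            _ ≤ ρ := by linarith
        · refine hflat y hyΩ (Or.inr ?_)
          calc dist y p₁ ≤ dist e y + dist e p₁ := dist_triangle_left _ _ _
            _ < δ + ϱ := add_lt_add_of_lt_of_le hey (mem_closedBall.1 he)
            _ ≤ ρ := by linarith
      have hz₁im : ((δ : ℂ) * hexCenter z₁).im ≤ h + 3 * δ := by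
        have h1 : ((δ : ℂ) * hexCenter z₁).im - y.im ≤ dist ((δ : ℂ) * hexCenter z₁) y := by
          rw [dist_eq_norm, ← Complex.sub_im]; exact Complex.im_le_norm _
        linarith
      obtain ⟨w, hw, hz₁w⟩ :=
        exists_pathIn_down_of_witness hδ hr hSU hyU (hz₁y.trans (by linarith)) hz₁im
      exact ⟨w, hw, hvz₁.trans hz₁w⟩
    · -- follow an exterior path from `e` until it first enters `Sx`
      set q : ℂ := ⟨y.re, h - 6 * δ - 1⟩ with hq
      have hclΩ : closure Ω ⊆ {z : ℂ | h ≤ z.im} := by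
        rw [← Complex.closure_setOf_lt_im]; exact closure_mono hΩh
      have hqE : q ∈ (closure Ω)ᶜ := by
        intro hqc
        have : h ≤ q.im := hclΩ hqc
        simp [hq] at this
        linarith
      have hqS : q ∈ Sx := Or.inl (Or.inl (by simp [hq]))
      have hEo : IsOpen (closure Ω)ᶜ := isClosed_closure.isOpen_compl
      have hpc : IsPathConnected (closure Ω)ᶜ := hEo.isConnected_iff_isPathConnected.1 hE
      have hJ : JoinedIn (closure Ω)ᶜ e q := hpc.joinedIn e heE q hqE
      set γ : Path e q := hJ.somePath with hγ
      have hγE : ∀ s : ℝ, γ.extend s ∈ (closure Ω)ᶜ := by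
        intro s
        have : γ.extend s ∈ range γ := by rw [← γ.extend_range]; exact mem_range_self s
        obtain ⟨t, ht⟩ := this
        rw [← ht]
        exact hJ.somePath_mem t
      obtain ⟨t, ht01, hpt, hpint, hbefore⟩ := exists_first_entry hSxc γ heS hqS
      set p : ℂ := γ.extend t with hp
      have hpΩ : p ∉ Ω := fun h' => hγE t (subset_closure h')
      have hpU : p ∉ U := by
        rintro ((h' | h') | h')
        · exact hpΩ h'
        · exact hpint (hintSx (Or.inl h'))
        · exact hpint (hintSx (Or.inr h'))
      have hpim : p.im ≤ h := by
        rcases hpt with (h' | h') | h'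
        · have : p.im ≤ h - 6 * δ := h'
          linarith
        · exact hflat p hpΩ (Or.inl ((mem_closedBall.1 h').trans_lt (by linarith)))
        · exact hflat p hpΩ (Or.inr ((mem_closedBall.1 h').trans_lt (by linarith)))
      -- the initial piece of the path and a lattice walk along it
      set P : Set ℂ := γ.extend '' Icc 0 t with hP
      have hPconn : IsPreconnected P := isPreconnected_Icc.image _ γ.continuous_extend.continuousOn
      have heP : e ∈ P := ⟨0, ⟨le_rfl, ht01.1⟩, γ.extend_zero⟩
      have hpP : p ∈ P := ⟨t, ⟨ht01.1, le_rfl⟩, rfl⟩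
      obtain ⟨z₂, hz₂p⟩ := exists_vertex_dist_le hδ p
      have hz₁e : dist ((δ : ℂ) * hexCenter z₁) e ≤ 2 * δ := by
        calc dist ((δ : ℂ) * hexCenter z₁) e ≤ dist ((δ : ℂ) * hexCenter z₁) y + dist e y :=
              dist_triangle_right _ _ _
          _ ≤ δ + δ := add_le_add hz₁y hey.le
          _ = 2 * δ := by ring
      obtain ⟨pw, hpw⟩ := exists_walk_near_of_isPreconnected hPconn hδ (r := 2 * δ) (by linarith)
        heP hpP hz₁e (hz₂p.trans (by linarith))
      have hz₁z₂ : PathIn hexGraph Sᶜ z₁ z₂ := by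
        refine pathIn_of_walk pw fun u hu huS => ?_
        obtain ⟨zz, ⟨s, hs, rfl⟩, hd⟩ := hpw u hu
        have hzzU : γ.extend s ∉ U := by
          have hzzΩ : γ.extend s ∉ Ω := fun h' => hγE s (subset_closure h')
          rcases eq_or_lt_of_le hs.2 with rfl | hst
          · exact hpU
          · have hzzS : γ.extend s ∉ Sx := hbefore s ⟨hs.1, hst⟩
            rintro ((h' | h') | h')
            · exact hzzΩ h'
            · exact hzzS (Or.inl (Or.inr (ball_subset_closedBall h')))
            · exact hzzS (Or.inr (ball_subset_closedBall h'))
        refine hzzU (hSU u huS ?_)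
        rw [mem_closedBall, dist_comm]
        linarith
      -- final descent from `z₂`, witnessed by `p`
      have hz₂im : ((δ : ℂ) * hexCenter z₂).im ≤ h + 3 * δ := by
        have h1 : ((δ : ℂ) * hexCenter z₂).im - p.im ≤ dist ((δ : ℂ) * hexCenter z₂) p := by
          rw [dist_eq_norm, ← Complex.sub_im]; exact Complex.im_le_norm _
        linarith
      obtain ⟨w, hw, hz₂w⟩ :=
        exists_pathIn_down_of_witness hδ hr hSU hpU (hz₂p.trans (by linarith)) hz₂im
      exact ⟨w, hw, (hvz₁.trans hz₁z₂).trans hz₂w⟩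
  -- CASE ANALYSIS on the violated condition
  by_cases hvΩ : (δ : ℂ) * hexCenter v ∈ Ω
  · by_cases hη : η ≤ ((δ : ℂ) * hexCenter v).im
    · have hball : ¬ closedBall ((δ : ℂ) * hexCenter v) r ⊆ U := fun h' => hv ⟨hvΩ, hη, h'⟩
      obtain ⟨y, hy, hyU⟩ := not_subset.1 hball
      exact key v y hyU (by rw [dist_comm]; exact mem_closedBall.1 hy)
    · push Not at hη
      exact exists_pathIn_down_of_height hδ fun u hu => hη.trans_le (hS u hu).2.1
  · by_cases hb : (δ : ℂ) * hexCenter v ∈ ball p₀ ϱ ∪ ball p₁ ϱ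
    · have hvim : ((δ : ℂ) * hexCenter v).im ≤ h := by
        refine hflat _ hvΩ ?_
        rcases hb with hb | hb
        · exact Or.inl ((mem_ball.1 hb).trans_le (by linarith))
        · exact Or.inr ((mem_ball.1 hb).trans_le (by linarith))
      exact exists_pathIn_down_of_height hδ fun u hu => hvim.trans_lt (hΩh (hS u hu).1)
    · refine key v ((δ : ℂ) * hexCenter v) ?_ (by rw [dist_self]; linarith)
      rintro ((h' | h') | h')
      · exact hvΩ h'
      · exact hb (Or.inl h')
      · exact hb (Or.inr h')



/-- **Registered sub-goal `stub_canonicalTransfer_escape`** (crux item stmt-CriticalPhenomena-10472,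
line `floor-ratio-restriction-bootstrap`, stub `stub_canonicalTransfer`): the escape lemma of the
inner admissible discretisation, registry form of `exists_pathIn_escape`. [folklore] -/
theorem stub_canonicalTransfer_escape :
    ∀ (Ω : Set ℂ) (h ρ ϱ δ r η : ℝ) (p₀ p₁ : ℂ) (S : Set HexVertex) (v : HexVertex),
    Ω ⊆ {z : ℂ | h < z.im} → IsConnected (closure Ω)ᶜ → frontier (closure Ω)ᶜ = frontier Ω →
    {z : ℂ | h < z.im} ∩ ball p₀ ρ ⊆ Ω → {z : ℂ | h < z.im} ∩ ball p₁ ρ ⊆ Ω →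
    ϱ + δ ≤ ρ → 0 < δ → 25 * δ ≤ r →
    (∀ u ∈ S, (δ : ℂ) * hexCenter u ∈ Ω ∧ η ≤ ((δ : ℂ) * hexCenter u).im ∧
      closedBall ((δ : ℂ) * hexCenter u) r ⊆ Ω ∪ ball p₀ ϱ ∪ ball p₁ ϱ) →
    ¬ ((δ : ℂ) * hexCenter v ∈ Ω ∧ η ≤ ((δ : ℂ) * hexCenter v).im ∧
      closedBall ((δ : ℂ) * hexCenter v) r ⊆ Ω ∪ ball p₀ ϱ ∪ ball p₁ ϱ) →
    ∃ w : HexVertex, ((δ : ℂ) * hexCenter w).im ≤ h - 5 * δ ∧ PathIn hexGraph Sᶜ v w :=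
  fun _ _ _ _ _ _ _ _ _ _ _ hΩh hE hEfr hfl₀ hfl₁ hϱρ hδ hr hS hv =>
    exists_pathIn_escape hΩh hE hEfr hfl₀ hfl₁ hϱρ hδ hr hS hv

end Summit.CriticalPhenomena.SAWScalingLimit.Theorems.ObservableToSLE.FloorRatio

end
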